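import Literature.AlgebraicGeometry.Resolution.SpreadingOutAlgebra
import Literature.AlgebraicGeometry.Resolution.IdealSheafDescent
import Mathlib.AlgebraicGeometry.Morphisms.Flat
import Mathlib.AlgebraicGeometry.IdealSheaf.Functorial
import HarnessLib

/-!
# The saturation of an ideal sheaf with respect to a global function (scheme-theoretic closure
# of `V(𝓜) ∩ D(g)`) and its compatibility with flat base change

Topic: `Literature/AlgebraicGeometry/Resolution`. For a scheme `X`, a quasi-coherent ideal sheaf
`𝓜` (Mathlib `Scheme.IdealSheafData`) and a global section `g ∈ Γ(X, 𝒪_X)`, the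
**`g`-saturation** `sat_g(𝓜)` is the ideal sheaf whose sections over an affine open `U` are the
`g|_U`-saturation `⋃ₙ (𝓜(U) : gⁿ)` of `𝓜(U)` (`satPowers`, `SpreadingOutAlgebra.lean`);
equivalently the largest ideal sheaf agreeing with `𝓜` on `D(g)`, i.e. the ideal of the
scheme-theoretic closure in `X` of the locally closed subscheme `V(𝓜) ∩ D(g)` (the "strict
transform" of `V(𝓜)` with respect to the divisor `V(g)`; Görtz–Wedhorn I, (13.19)). This is the
device by which a resolution of singularities constructed over the generic point of an integral
base is spread out (`EffectiveResolutionSpread*.lean`): the closure is formed over the base and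
over the generic fibre by the SAME formula, and the two agree because saturation commutes with
FLAT base change. All PROVED:

* `satIdealSheaf 𝓜 g` — the definition (quasi-coherence = `map_satPowers_of_flat` for the
  flat localization maps `Γ(U) → Γ(U_f)`), `le_satIdealSheaf`, `satIdealSheaf_ideal_of_le`
  (`= 𝓜` on affine opens inside `D(g)`), `comap_ι_satIdealSheaf` (`= 𝓜` on `D(g)`);
* `comap_satIdealSheaf_of_flat` — **`ι^*(sat_g 𝓜) = sat_{ι^*g}(ι^*𝓜)` for `ι : X' → X` affine and
  flat**;
* `support_satIdealSheaf` — `Supp sat_g(𝓜) = closure (Supp 𝓜 ∩ D(g))`;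
* `radical_satIdealSheaf`, `satIdealSheaf_eq_vanishingIdeal` — if `𝓜` is radical on `D(g)` then
  `sat_g(𝓜)` is the (reduced) vanishing ideal sheaf of `closure (Supp 𝓜 ∩ D(g))`;
* `isRadical_ideal_of_radical_comap_ι` — radicality on the opens inside `W` from radicality of
  the restriction `𝓜|_W`.

## Sources

* U. Görtz, T. Wedhorn, *Algebraic Geometry I*, 2nd ed. (2020), (13.19) (schematic closure of
  `π⁻¹(Y ∖ Z)`), Prop. 10.30 (scheme-theoretic image), §(14.12) (flat base change).
  [GortzWedhorn2020]
* A. Grothendieck, EGA IV₂ 2.3.2 (schematic image and flat base change). [folklore]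
-/

noncomputable section

universe u

open CategoryTheory CategoryTheory.Limits AlgebraicGeometry TopologicalSpace Opposite

namespace Literature.AlgebraicGeometry.Resolution

open Scheme.IdealSheafData

/-! ## Two more facts on the saturation of an ideal -/

/-- Saturation commutes with flat base change, ring-hom form. [folklore] -/
theorem map_satPowers_of_ringHom_flat {B B' : Type*} [CommRing B] [CommRing B']
    (φ : B →+* B') (hφ : φ.Flat) (N : Ideal B) (u : B) :
    (satPowers N u).map φ = satPowers (N.map φ) (φ u) := by
  letI := φ.toAlgebra
  haveI : Module.Flat B B' := hφ
  exact map_satPowers_of_flat N u B'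

/-- Saturating with respect to a unit does nothing. [folklore] -/
theorem satPowers_eq_self_of_isUnit {B : Type*} [CommRing B] (N : Ideal B) {u : B}
    (hu : IsUnit u) : satPowers N u = N := by
  refine le_antisymm (fun b hb => ?_) (le_satPowers N u)
  obtain ⟨n, hn⟩ := mem_satPowers_iff.mp hb
  obtain ⟨v, hv⟩ := (hu.pow n).exists_left_inv
  have : b = v * (u ^ n * b) := by rw [← mul_assoc, hv, one_mul]
  rw [this]
  exact Ideal.mul_mem_left _ _ hn

/-- A radical ideal has radical saturations with respect to the localization: if `N B[1/u]` is
radical then so is `sat_u(N)` (both are contractions of `N B[1/u]`). [folklore] -/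
theorem isRadical_satPowers {B : Type*} [CommRing B] (N : Ideal B) (u : B) (S : Type*)
    [CommRing S] [Algebra B S] [IsLocalization.Away u S]
    (h : (N.map (algebraMap B S)).IsRadical) : (satPowers N u).IsRadical := by
  rw [satPowers_eq_comap_map N u S]
  exact h.comap _

variable {X : Scheme.{u}}

/-- Restriction of a global section to an open, composed. [folklore] -/
theorem res_res_top (g : Γ(X, ⊤)) {U V : X.Opens} (h : V ≤ U) :
    X.presheaf.map (homOfLE h).op (X.presheaf.map (homOfLE (le_top : U ≤ ⊤)).op g) =
      X.presheaf.map (homOfLE (le_top : V ≤ ⊤)).op g := by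
  rw [← CommRingCat.comp_apply, ← X.presheaf.map_comp]
  rfl

/-- A global section `g` restricts to a unit on every open inside `D(g)`. [folklore] -/
theorem isUnit_res_of_le_basicOpen (g : Γ(X, ⊤)) {V : X.Opens} (hV : V ≤ X.basicOpen g) :
    IsUnit (X.presheaf.map (homOfLE (le_top : V ≤ ⊤)).op g) := by
  have h1 := RingedSpace.isUnit_res_basicOpen (X := X.toLocallyRingedSpace.toRingedSpace) g
  have h2 := h1.map (X.presheaf.map (homOfLE hV).op).hom
  change IsUnit (X.presheaf.map (homOfLE hV).op
    (X.presheaf.map (homOfLE (X.basicOpen_le g)).op g)) at h2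
  rwa [res_res_top g hV] at h2

/-! ## The saturated ideal sheaf -/

/-- **The `g`-saturation of an ideal sheaf `𝓜`**: over an affine open `U` its ideal is
`⋃ₙ (𝓜(U) : (g|_U)ⁿ)`, the contraction of `𝓜(U) Γ(U)[1/g]` — the ideal sheaf of the
scheme-theoretic closure of `V(𝓜) ∩ D(g)` in `X`. Quasi-coherence holds because saturation
commutes with the flat localization maps `Γ(U) → Γ(U_f)`. [cite: GortzWedhorn2020, (13.19)] -/
def satIdealSheaf (M : X.IdealSheafData) (g : Γ(X, ⊤)) : X.IdealSheafData where
  ideal U := satPowers (M.ideal U) (X.presheaf.map (homOfLE (le_top : (U : X.Opens) ≤ ⊤)).op g)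
  map_ideal_basicOpen U f := by
    have hflat : (X.presheaf.map (homOfLE (X.basicOpen_le f)).op).hom.Flat := by
      letI : Algebra Γ(X, U) Γ(X, X.affineBasicOpen f) :=
        (X.presheaf.map (homOfLE (X.basicOpen_le f)).op).hom.toAlgebra
      have : IsLocalization.Away f Γ(X, X.basicOpen f) :=
        U.2.isLocalization_of_eq_basicOpen _ _ rfl
      exact IsLocalization.flat Γ(X, X.basicOpen f) (Submonoid.powers f)
    rw [map_satPowers_of_ringHom_flat _ hflat, M.map_ideal_basicOpen]
    congr 1
    exact res_res_top g (X.basicOpen_le f)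

variable (M : X.IdealSheafData) (g : Γ(X, ⊤))

/-- The ideal of the saturation over an affine open. [folklore] -/
theorem satIdealSheaf_ideal (U : X.affineOpens) :
    (satIdealSheaf M g).ideal U =
      satPowers (M.ideal U) (X.presheaf.map (homOfLE (le_top : (U : X.Opens) ≤ ⊤)).op g) :=
  rfl

/-- `𝓜 ⊆ sat_g(𝓜)`. [folklore] -/
theorem le_satIdealSheaf : M ≤ satIdealSheaf M g := fun _ => le_satPowers _ _

/-- **On affine opens inside `D(g)` the saturation does nothing.** [folklore] -/
theorem satIdealSheaf_ideal_of_le {V : X.affineOpens} (hV : (V : X.Opens) ≤ X.basicOpen g) :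
    (satIdealSheaf M g).ideal V = M.ideal V :=
  satPowers_eq_self_of_isUnit _ (isUnit_res_of_le_basicOpen g hV)

/-- **On `D(g)` the saturation restricts to `𝓜`**: `sat_g(𝓜)|_{D(g)} = 𝓜|_{D(g)}`. [folklore] -/
theorem comap_ι_satIdealSheaf :
    (satIdealSheaf M g).comap (X.basicOpen g).ι = M.comap (X.basicOpen g).ι := by
  apply Scheme.IdealSheafData.ext
  funext U'
  rw [ideal_comap_of_isOpenImmersion, ideal_comap_of_isOpenImmersion,
    satIdealSheaf_ideal_of_le M g ((X.basicOpen g).ι_image_le U')]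

/-! ## Flat base change -/

/-- **Saturation commutes with flat (affine) base change**: for `ι : X' → X` affine and flat,
`ι^*(sat_g 𝓜) = sat_{ι^* g}(ι^* 𝓜)` — the formation of the scheme-theoretic closure of
`V(𝓜) ∩ D(g)` commutes with flat base change (EGA IV₂ 2.3.2; here from
`map_satPowers_of_flat` on the affine charts `ι⁻¹ U`).
[cite: GortzWedhorn2020, §(14.12)] -/
theorem comap_satIdealSheaf_of_flat {X' : Scheme.{u}} (ι : X' ⟶ X) [IsAffineHom ι] [Flat ι] :
    (satIdealSheaf M g).comap ι = satIdealSheaf (M.comap ι) (ι.appTop g) := by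
  refine ext_of_iSup_eq_top (fun V : X.affineOpens => ⟨ι ⁻¹ᵁ V, V.2.preimage ι⟩) ?_ ?_
  · rw [← Scheme.Hom.preimage_iSup, iSup_affineOpens_eq_top]
    rfl
  · intro V
    rw [ideal_comap_preimage_of_isAffineHom, satIdealSheaf_ideal, satIdealSheaf_ideal,
      ideal_comap_preimage_of_isAffineHom]
    have hflat : (ι.app V).hom.Flat := by
      have := HasRingHomProperty.appLE @Flat ι inferInstance V ⟨ι ⁻¹ᵁ V, V.2.preimage ι⟩ le_rfl
      rwa [Scheme.Hom.appLE_eq_app] at this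
    rw [map_satPowers_of_ringHom_flat _ hflat]
    congr 1
    have := ι.naturality (homOfLE (le_top : (V : X.Opens) ≤ ⊤)).op
    have h := congrArg (fun φ => φ.hom g) this
    simp only [CommRingCat.hom_comp, RingHom.coe_comp, Function.comp_apply] at h
    rw [h]
    rfl

/-! ## Support and radicality -/

/-- **`Supp sat_g(𝓜) = closure (Supp 𝓜 ∩ D(g))`.** [cite: GortzWedhorn2020, (13.19)] -/
theorem support_satIdealSheaf :
    ((satIdealSheaf M g).support : Set X) = closure ((M.support : Set X) ∩ X.basicOpen g) := by
  apply le_antisymm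
  · -- a point of the support off the closure has an affine neighbourhood `U` missing
    -- `Supp 𝓜 ∩ D(g)`; then `𝓜(U ∩ D(g)) = ⊤`, so `1 ∈ sat_g(𝓜)(U)`
    intro x hx
    by_contra hxZ
    obtain ⟨U, hU, hxU, hUZ⟩ := exists_isAffineOpen_mem_and_subset (X := X) (x := x)
      (U := ⟨(closure ((M.support : Set X) ∩ X.basicOpen g))ᶜ, isClosed_closure.isOpen_compl⟩)
      hxZ
    set gU : Γ(X, U) := X.presheaf.map (homOfLE (le_top : U ≤ ⊤)).op g with hgU
    let V : X.affineOpens := X.affineBasicOpen (U := ⟨U, hU⟩) gU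
    have hVU : (V : X.Opens) ≤ U := X.basicOpen_le gU
    have hVg : (V : X.Opens) ≤ X.basicOpen g := by
      change X.basicOpen gU ≤ X.basicOpen g
      rw [hgU, Scheme.basicOpen_res]
      exact inf_le_right
    -- `𝓜(V) = ⊤`
    have hMV : M.ideal V = ⊤ := by
      have hempty : X.zeroLocus (U := V.1) (M.ideal V) ∩ V.1 = ∅ := by
        rw [← coe_support_inter]
        ext y
        simp only [Set.mem_inter_iff, Set.mem_empty_iff_false, iff_false, not_and]
        intro hyM hyV
        exact hUZ (hVU hyV) (subset_closure ⟨hyM, hVg hyV⟩)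
      rw [← PrimeSpectrum.zeroLocus_empty_iff_eq_top]
      have himg := V.2.fromSpec_image_zeroLocus (M.ideal V : Set Γ(X, V))
      rw [hempty, Set.image_eq_empty] at himg
      exact himg
    -- hence `1 ∈ sat_g(𝓜)(U)`
    have hone : (1 : Γ(X, U)) ∈ (satIdealSheaf M g).ideal ⟨U, hU⟩ := by
      change (1 : Γ(X, U)) ∈ satPowers (M.ideal ⟨U, hU⟩) gU
      letI : Algebra Γ(X, U) Γ(X, X.affineBasicOpen (U := ⟨U, hU⟩) gU) :=
        (X.presheaf.map (homOfLE (X.basicOpen_le gU)).op).hom.toAlgebra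
      have : IsLocalization.Away gU Γ(X, X.basicOpen gU) :=
        hU.isLocalization_of_eq_basicOpen _ _ rfl
      rw [satPowers_eq_comap_map _ gU Γ(X, X.basicOpen gU), Ideal.mem_comap, map_one,
        RingHom.algebraMap_toAlgebra, M.map_ideal_basicOpen ⟨U, hU⟩ gU]
      change (1 : Γ(X, V)) ∈ M.ideal V
      rw [hMV]
      trivial
    have htop : (satIdealSheaf M g).ideal ⟨U, hU⟩ = ⊤ := Ideal.eq_top_of_isUnit_mem _ hone isUnit_one
    have hx' : x ∈ (satIdealSheaf M g).support := hx
    rw [mem_support_iff_of_mem (U := ⟨U, hU⟩) hxU, htop] at hx'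
    have : x ∈ X.basicOpen (1 : Γ(X, U)) := by
      rw [X.basicOpen_of_isUnit isUnit_one]
      exact hxU
    exact ((Scheme.mem_zeroLocus_iff _ _ _).mp hx') 1 trivial this
  · -- the support is closed and contains `Supp 𝓜 ∩ D(g)` (there `sat_g 𝓜 = 𝓜`)
    refine closure_minimal ?_ (satIdealSheaf M g).support.isClosed
    rintro x ⟨hxM, hxg⟩
    obtain ⟨U, hU, hxU, hUg⟩ :=
      exists_isAffineOpen_mem_and_subset (X := X) (x := x) (U := X.basicOpen g) hxg
    have hxM' : x ∈ M.support := hxM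
    change x ∈ (satIdealSheaf M g).support
    rw [mem_support_iff_of_mem (U := ⟨U, hU⟩) hxU] at hxM' ⊢
    rwa [satIdealSheaf_ideal_of_le M g (V := ⟨U, hU⟩) hUg]

/-- **If `𝓜` is radical on the affine opens inside `D(g)` then `sat_g(𝓜)` is radical.**
[folklore] -/
theorem radical_satIdealSheaf
    (hrad : ∀ V : X.affineOpens, (V : X.Opens) ≤ X.basicOpen g → (M.ideal V).IsRadical) :
    (satIdealSheaf M g).radical = satIdealSheaf M g := by
  apply Scheme.IdealSheafData.ext
  funext U
  rw [radical_ideal]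
  apply Ideal.IsRadical.radical
  -- `sat(𝓜(U))` is the contraction of `𝓜(U_g)`, which is radical
  change (satPowers (M.ideal U) _).IsRadical
  set gU : Γ(X, U) := X.presheaf.map (homOfLE (le_top : (U : X.Opens) ≤ ⊤)).op g with hgU
  letI : Algebra Γ(X, U) Γ(X, X.affineBasicOpen gU) :=
    (X.presheaf.map (homOfLE (X.basicOpen_le gU)).op).hom.toAlgebra
  have : IsLocalization.Away gU Γ(X, X.basicOpen gU) := U.2.isLocalization_of_eq_basicOpen _ _ rfl
  apply isRadical_satPowers _ gU Γ(X, X.basicOpen gU)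
  rw [RingHom.algebraMap_toAlgebra, M.map_ideal_basicOpen U gU]
  apply hrad
  change X.basicOpen gU ≤ X.basicOpen g
  rw [hgU, Scheme.basicOpen_res]
  exact inf_le_right

/-- **The saturation as a reduced closure**: if `𝓜` is radical on the affine opens inside `D(g)`,
then `sat_g(𝓜)` is the vanishing ideal sheaf (reduced induced structure) of the closed set
`closure (Supp 𝓜 ∩ D(g))`. [cite: GortzWedhorn2020, (13.19)] -/
theorem satIdealSheaf_eq_vanishingIdeal
    (hrad : ∀ V : X.affineOpens, (V : X.Opens) ≤ X.basicOpen g → (M.ideal V).IsRadical) :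
    satIdealSheaf M g =
      vanishingIdeal ⟨closure ((M.support : Set X) ∩ X.basicOpen g), isClosed_closure⟩ := by
  have hsupp : (satIdealSheaf M g).support =
      ⟨closure ((M.support : Set X) ∩ X.basicOpen g), isClosed_closure⟩ := by
    ext1
    exact support_satIdealSheaf M g
  rw [← hsupp, vanishingIdeal_support, radical_satIdealSheaf M g hrad]

/-! ## Radicality on the opens inside `W` from radicality of the restriction to `W` -/

/-- If the restriction `𝓜|_W` of an ideal sheaf to an open `W` is radical, then `𝓜(V)` is a
radical ideal for every affine open `V ⊆ W`. [folklore] -/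
theorem isRadical_ideal_of_radical_comap_ι {W : X.Opens}
    (h : (M.comap W.ι).radical = M.comap W.ι) (V : X.affineOpens) (hV : (V : X.Opens) ≤ W) :
    (M.ideal V).IsRadical := by
  -- the affine open `W.ι⁻¹ V` of `W`, with image `V`
  have hVr : (V : X.Opens) ≤ W.ι.opensRange := by rwa [Scheme.Opens.opensRange_ι]
  let U' : (W : Scheme.{u}).affineOpens := ⟨W.ι ⁻¹ᵁ V, V.2.preimage_of_isOpenImmersion W.ι hVr⟩
  have himg : W.ι ''ᵁ (U' : (W : Scheme.{u}).Opens) = V := by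
    change W.ι ''ᵁ (W.ι ⁻¹ᵁ V) = V
    rw [Scheme.Hom.image_preimage_eq_opensRange_inf, Scheme.Opens.opensRange_ι,
      inf_eq_right.mpr hV]
  have hV' : (⟨W.ι ''ᵁ U', U'.2.image_of_isOpenImmersion W.ι⟩ : X.affineOpens) = V :=
    Subtype.ext himg
  -- `(𝓜|_W)(U')` is radical and is the preimage of `𝓜(V)` under an isomorphism
  have hU' : ((M.comap W.ι).ideal U').IsRadical := by
    rw [← h, radical_ideal]
    exact Ideal.radical_isRadical _
  rw [ideal_comap_of_isOpenImmersion] at hU'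
  rw [← hV']
  -- transport back along the isomorphism
  set V' : X.affineOpens := ⟨W.ι ''ᵁ U', U'.2.image_of_isOpenImmersion W.ι⟩
  have e : M.ideal V' =
      (((M.ideal V').comap (W.ι.appIso U').inv.hom).comap (W.ι.appIso U').hom.hom) := by
    rw [Ideal.comap_comap, ← CommRingCat.hom_comp, Iso.hom_inv_id, CommRingCat.hom_id,
      Ideal.comap_id]
  rw [e]
  exact hU'.comap _

/-- Radicality of an ideal sheaf pulls back along open immersions. [folklore] -/
theorem radical_comap_of_isOpenImmersion {Y : Scheme.{u}} (L : Y.IdealSheafData)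
    (hL : L.radical = L) (f : X ⟶ Y) [IsOpenImmersion f] : (L.comap f).radical = L.comap f := by
  apply Scheme.IdealSheafData.ext
  funext U
  rw [radical_ideal, ideal_comap_of_isOpenImmersion]
  apply Ideal.IsRadical.radical
  refine Ideal.IsRadical.comap _ ?_
  rw [← hL, radical_ideal]
  exact Ideal.radical_isRadical _

end Literature.AlgebraicGeometry.Resolution

end
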